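import Mathlib

/-!
# Specialisation of a transcendental parameter, and the exchange lemma

Folklore commutative algebra behind "specialise the curve `(x₀, x₁, s)` over `ℚ̄` at `s ↦ c`":

* `exists_valuationSubring` — for `s ∈ ℂ` transcendental and `c ∈ ℚ`, Chevalley's theorem
  (Mathlib's `IsLocalRing.exists_factor_valuationRing` applied to `ℚ[X]_(X − c) → ℂ`,
  `X ↦ s`) gives a valuation ring `V ∋ s` of `ℂ` in which `s − c` is not a unit but `h(s)` is
  whenever `h(c) ≠ 0`.
* `exists_leadingCoeff_witness` — an element algebraic over `ℚ[s]` lies in such `V` once the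
  leading coefficient of its equation is a unit (valuation rings are integrally closed).
* `exists_specialization` — if `x₀, x₁` are algebraic over `ℚ[s]`, then for all but finitely
  many `c ∈ ℚ` every rational polynomial relation of `(x₀, x₁, s)` holds at some algebraic
  point `(a₀, a₁, c)` (the ideal of relations plus `X₂ − c` is proper since `s − c` is a
  non-unit of `V ⊇ ℚ[x₀, x₁, s]`; weak Nullstellensatz `vanishingIdeal_zeroLocus_eq_radical`).
* `isAlgebraic_adjoin_exchange`, `isAlgebraic_adjoin_period` — the exchange lemma for algebraic
  dependence of pairs, from Mathlib's `AlgebraicIndependent.iff_transcendental_adjoin_image`.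

## References

* [Lang2002] S. Lang, *Algebra*, 3rd ed., Springer GTM 211, Ch. VII §3 (valuation rings,
  extension of homomorphisms), Ch. VIII §1 (exchange lemma), Ch. IX §1 (Nullstellensatz).
* C. Chevalley, *Introduction to the theory of algebraic functions of one variable*, AMS 1951,
  Ch. I §2 (extension of places).
-/

noncomputable section

open scoped Polynomial
open Complex Set

namespace Literature.NumberTheory.Transcendental.Specialization

/-- A valuation subring of `ℂ` as a `ℚ`-subalgebra, given that it contains the rationals. [folklore] -/
def vsubalg (V : ValuationSubring ℂ) (hVq : ∀ q : ℚ, (q : ℂ) ∈ V) : Subalgebra ℚ ℂ :=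
  { V.toSubring.toSubsemiring with
    algebraMap_mem' := fun q => by simpa using hVq q }

/-- Membership in `vsubalg`. [folklore] -/
theorem mem_vsubalg {V : ValuationSubring ℂ} {hVq : ∀ q : ℚ, (q : ℂ) ∈ V} {z : ℂ} :
    z ∈ vsubalg V hVq ↔ z ∈ V := Iff.rfl

/-- For `s` transcendental and `c ∈ ℚ` there is a valuation subring `V ∋ s` of `ℂ` containing
`ℚ` in which `s - c` is not a unit but `h(s)` is a unit whenever `h ∈ ℚ[X]`, `h(c) ≠ 0`
(Chevalley: a valuation ring dominating the local ring `ℚ[X]_{(X - c)} → ℂ`, `X ↦ s`).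
[cite: Lang2002, Ch. VII §3 (Chevalley extension of places)] -/
theorem exists_valuationSubring {s : ℂ} (hs : Transcendental ℚ s) (c : ℚ) :
    ∃ V : ValuationSubring ℂ, (∀ q : ℚ, (q : ℂ) ∈ V) ∧ s ∈ V ∧
      (∀ hsc : s - c ∈ V, ¬ IsUnit (⟨s - c, hsc⟩ : V)) ∧
      ∀ h : ℚ[X], h.eval c ≠ 0 → ∃ hm : Polynomial.aeval s h ∈ V, IsUnit (⟨_, hm⟩ : V) := by
  set P : Ideal ℚ[X] := Ideal.span {Polynomial.X - Polynomial.C c} with hPdef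
  haveI hP : P.IsPrime :=
    (Ideal.span_singleton_prime (Polynomial.X_sub_C_ne_zero c)).mpr (Polynomial.irreducible_X_sub_C c).prime
  set A := Localization.AtPrime P
  have hunits : ∀ y : P.primeCompl,
      IsUnit ((Polynomial.aeval s : ℚ[X] →ₐ[ℚ] ℂ).toRingHom y) := by
    intro y
    apply isUnit_iff_ne_zero.mpr
    intro h0
    have hy : (y : ℚ[X]) ∉ P := y.2
    apply hy
    have hy0 : (y : ℚ[X]) = 0 := by
      rw [transcendental_iff] at hs
      exact hs _ h0
    rw [hy0]
    exact P.zero_mem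
  set f : A →+* ℂ := IsLocalization.lift hunits with hf
  obtain ⟨V, hV, hloc⟩ := IsLocalRing.exists_factor_valuationRing f
  have hfalg : ∀ p : ℚ[X], f (algebraMap ℚ[X] A p) = Polynomial.aeval s p := fun p =>
    IsLocalization.lift_eq hunits p
  refine ⟨V, ?_, ?_, ?_, ?_⟩
  · intro q
    have := hV (algebraMap ℚ[X] A (Polynomial.C q))
    rw [hfalg, Polynomial.aeval_C] at this
    simpa using this
  · have := hV (algebraMap ℚ[X] A Polynomial.X)
    rwa [hfalg, Polynomial.aeval_X] at this
  · intro hsc hu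
    have hz : algebraMap ℚ[X] A (Polynomial.X - Polynomial.C c) ∈ IsLocalRing.maximalIdeal A :=
      (IsLocalization.AtPrime.to_map_mem_maximal_iff A P _).mpr (Ideal.subset_span rfl)
    have hnu : ¬ IsUnit (algebraMap ℚ[X] A (Polynomial.X - Polynomial.C c)) :=
      (IsLocalRing.mem_maximalIdeal _).mp hz
    apply hnu
    apply hloc.map_nonunit
    have e : (f.codRestrict V.toSubring hV) (algebraMap ℚ[X] A (Polynomial.X - Polynomial.C c)) = ⟨s - c, hsc⟩ := by
      apply Subtype.ext
      simp only [RingHom.codRestrict_apply]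
      rw [hfalg]
      simp
    rw [e]
    exact hu
  · intro h hc
    have hnot : h ∉ P := by
      rw [hPdef, Ideal.mem_span_singleton, Polynomial.dvd_iff_isRoot]
      exact hc
    have hu : IsUnit (algebraMap ℚ[X] A h) := IsLocalization.map_units A (⟨h, hnot⟩ : P.primeCompl)
    have hu' := hu.map (f.codRestrict V.toSubring hV)
    have hm : Polynomial.aeval s h ∈ V := by
      have := hV (algebraMap ℚ[X] A h)
      rwa [hfalg] at this
    refine ⟨hm, ?_⟩
    have e : (f.codRestrict V.toSubring hV) (algebraMap ℚ[X] A h) = ⟨Polynomial.aeval s h, hm⟩ := by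
      apply Subtype.ext
      simp only [RingHom.codRestrict_apply]
      rw [hfalg]
    rw [e] at hu'
    exact hu'


/-- An element algebraic over `ℚ[s]` lies in every valuation subring `V ∋ s` of `ℂ` containing
`ℚ` in which the leading coefficient `h(s)` of one of its equations is a unit (valuation rings are
integrally closed). [folklore] -/
theorem exists_leadingCoeff_witness {s z : ℂ} (hz : IsAlgebraic (Algebra.adjoin ℚ ({s} : Set ℂ)) z) :
    ∃ h : ℚ[X], h ≠ 0 ∧ ∀ V : ValuationSubring ℂ, (∀ q : ℚ, (q : ℂ) ∈ V) → s ∈ V →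
      (∀ hm : Polynomial.aeval s h ∈ V, IsUnit (⟨_, hm⟩ : V)) → z ∈ V := by
  set R₁ : Subalgebra ℚ ℂ := Algebra.adjoin ℚ ({s} : Set ℂ) with hR₁
  obtain ⟨p, hp0, hpz⟩ := hz
  have hlc : p.leadingCoeff ≠ 0 := fun h => hp0 (Polynomial.leadingCoeff_eq_zero.mp h)
  have hmem : ((p.leadingCoeff : R₁) : ℂ) ∈ (Polynomial.aeval s : ℚ[X] →ₐ[ℚ] ℂ).range := by
    rw [← Algebra.adjoin_singleton_eq_range_aeval]
    exact (p.leadingCoeff).2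
  obtain ⟨h, hh⟩ := hmem
  have hh' : Polynomial.aeval s h = ((p.leadingCoeff : R₁) : ℂ) := hh
  refine ⟨h, ?_, ?_⟩
  · intro h0
    apply hlc
    apply Subtype.ext
    change ((p.leadingCoeff : R₁) : ℂ) = 0
    rw [← hh', h0, map_zero]
  intro V hVq hVs hunit
  -- `R₁ ⊆ V`
  have hR₁V : ∀ r : R₁, (r : ℂ) ∈ V := by
    intro r
    have : (r : ℂ) ∈ vsubalg V hVq := by
      refine (Algebra.adjoin_le ?_ : R₁ ≤ vsubalg V hVq) r.2
      intro t ht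
      rw [Set.mem_singleton_iff] at ht
      subst ht
      exact hVs
    exact this
  have hhV : Polynomial.aeval s h ∈ V := by rw [hh']; exact hR₁V _
  obtain ⟨u, hu⟩ := hunit hhV
  -- the monic equation of `z` over `V`
  set Pc : ℂ[X] := p.map (algebraMap R₁ ℂ) with hPc
  have hinj : Function.Injective (algebraMap R₁ ℂ) := Subtype.val_injective
  have hPc0 : Pc ≠ 0 := fun h0 => hp0 ((Polynomial.map_eq_zero_iff hinj).mp h0)
  have hPclc : Pc.leadingCoeff = Polynomial.aeval s h := by
    rw [hPc, Polynomial.leadingCoeff_map_of_injective hinj, hh']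
    rfl
  have hPcz : Pc.eval z = 0 := by
    rw [hPc, Polynomial.eval_map, ← Polynomial.aeval_def]
    exact hpz
  set Q : ℂ[X] := Pc * Polynomial.C (Pc.leadingCoeff)⁻¹ with hQ
  have hQm : Q.Monic := Polynomial.monic_mul_leadingCoeff_inv hPc0
  have hinvV : ((Pc.leadingCoeff)⁻¹ : ℂ) = ((↑(u⁻¹) : V) : ℂ) := by
    rw [hPclc]
    have h1 : ((↑u : V) : ℂ) * ((↑(u⁻¹) : V) : ℂ) = 1 := by
      have h2 : ((↑u : V) * (↑(u⁻¹) : V) : V) = 1 := u.mul_inv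
      have h3 := congrArg (fun v : V => (v : ℂ)) h2
      exact h3
    rw [hu] at h1
    exact (eq_inv_of_mul_eq_one_right h1).symm
  have hQlifts : Q ∈ Polynomial.lifts (algebraMap V ℂ) := by
    rw [Polynomial.lifts_iff_coeff_lifts]
    intro n
    rw [hQ, Polynomial.coeff_mul_C, hPc, Polynomial.coeff_map, hinvV]
    exact ⟨⟨_, hR₁V (p.coeff n)⟩ * (↑(u⁻¹) : V), rfl⟩
  obtain ⟨q, hqQ, -, hqm⟩ := Polynomial.lifts_and_natDegree_eq_and_monic hQlifts hQm
  have hint : IsIntegral V z := by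
    refine ⟨q, hqm, ?_⟩
    rw [Polynomial.eval₂_eq_eval_map, hqQ, hQ, Polynomial.eval_mul, hPcz, zero_mul]
  obtain ⟨y, hy⟩ := (IsIntegrallyClosedIn.isIntegral_iff (R := V) (A := ℂ)).mp hint
  rw [← hy]
  exact y.2

/-- SPECIALISATION. If `s` is transcendental and `x₀, x₁` are algebraic over `ℚ[s]`, then for all
but finitely many `c ∈ ℚ` the point `(x₀, x₁, s)` specialises to an algebraic point `(a₀, a₁, c)`:
every rational polynomial relation of `(x₀, x₁, s)` holds at `(a₀, a₁, c)` (Chevalley's valuation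
ring through `s ↦ c` makes `s - c` a non-unit of `ℚ[x₀, x₁, s]`; weak Nullstellensatz).
[cite: Lang2002, Ch. IX §1 (Hilbert Nullstellensatz), Ch. VII §3] -/
theorem exists_specialization {x : Fin 2 → ℂ} {s : ℂ} (hs : Transcendental ℚ s)
    (halgx : ∀ j, IsAlgebraic (Algebra.adjoin ℚ ({s} : Set ℂ)) (x j)) :
    ∃ S : Set ℚ, S.Finite ∧ ∀ c : ℚ, c ∉ S → ∃ a : Fin 3 → algebraicClosure ℚ ℂ,
      a 2 = algebraMap ℚ _ c ∧
      ∀ P : MvPolynomial (Fin 3) ℚ, MvPolynomial.aeval ![x 0, x 1, s] P = 0 →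
        MvPolynomial.aeval a P = 0 := by
  choose h hh0 hhV using fun j => exists_leadingCoeff_witness (halgx j)
  refine ⟨{c | (h 0 * h 1).IsRoot c}, Polynomial.finite_setOf_isRoot (mul_ne_zero (hh0 0) (hh0 1)),
    ?_⟩
  intro c hc
  have hc' : ∀ j, (h j).eval c ≠ 0 := by
    intro j h0
    apply hc
    show (h 0 * h 1).IsRoot c
    rw [Polynomial.IsRoot, Polynomial.eval_mul, mul_eq_zero]
    fin_cases j
    · left; simpa using h0
    · right; simpa using h0
  obtain ⟨V, hVq, hVs, hVsc, hVh⟩ := exists_valuationSubring hs c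
  have hxV : ∀ j, x j ∈ V := by
    intro j
    refine hhV j V hVq hVs fun hm => ?_
    obtain ⟨hm', hu⟩ := hVh (h j) (hc' j)
    exact hu
  -- the ideal of relations plus `X₂ - c` is proper
  set ev := (MvPolynomial.aeval ![x 0, x 1, s] : MvPolynomial (Fin 3) ℚ →ₐ[ℚ] ℂ) with hev
  set J : Ideal (MvPolynomial (Fin 3) ℚ) :=
    RingHom.ker ev.toRingHom ⊔ Ideal.span {MvPolynomial.X 2 - MvPolynomial.C c} with hJ
  have hJtop : J ≠ ⊤ := by
    intro hJtop
    have h1 : (1 : MvPolynomial (Fin 3) ℚ) ∈ J := hJtop ▸ Submodule.mem_top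
    obtain ⟨i, hi, r, hr, hir⟩ := Submodule.mem_sup.mp h1
    obtain ⟨t, rfl⟩ := Ideal.mem_span_singleton'.mp hr
    have hi0 : ev i = 0 := hi
    have key := congrArg ev hir
    rw [map_add, hi0, zero_add, map_mul, map_one, map_sub, MvPolynomial.aeval_X,
      MvPolynomial.aeval_C] at key
    have htV : ev t ∈ V := by
      have hmem : ev t ∈ Algebra.adjoin ℚ (Set.range ![x 0, x 1, s]) := by
        rw [Algebra.adjoin_range_eq_range_aeval]
        exact ⟨t, rfl⟩
      refine (Algebra.adjoin_le ?_ : Algebra.adjoin ℚ (Set.range ![x 0, x 1, s]) ≤ vsubalg V hVq) hmem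
      rintro _ ⟨m, rfl⟩
      fin_cases m
      · exact hxV 0
      · exact hxV 1
      · exact hVs
    have hscV : s - (c : ℂ) ∈ V := V.toSubring.sub_mem hVs (hVq c)
    apply hVsc hscV
    refine IsUnit.of_mul_eq_one (⟨ev t, htV⟩ : V) ?_
    apply Subtype.ext
    change (s - (c : ℂ)) * ev t = 1
    rw [mul_comm]
    convert key using 2
    simp
  -- weak Nullstellensatz: a common algebraic zero
  haveI : IsAlgClosed (algebraicClosure ℚ ℂ) := (algebraicClosure.isAlgClosure ℚ ℂ).isAlgClosed
  have hne : (MvPolynomial.zeroLocus (algebraicClosure ℚ ℂ) J).Nonempty := by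
    by_contra hempty
    rw [Set.not_nonempty_iff_eq_empty] at hempty
    have hrad := MvPolynomial.vanishingIdeal_zeroLocus_eq_radical (K := algebraicClosure ℚ ℂ) J
    rw [hempty, MvPolynomial.vanishingIdeal_empty] at hrad
    exact hJtop (Ideal.radical_eq_top.mp hrad.symm)
  obtain ⟨a, ha⟩ := hne
  rw [MvPolynomial.mem_zeroLocus_iff] at ha
  refine ⟨a, ?_, ?_⟩
  · have h2 := ha (MvPolynomial.X 2 - MvPolynomial.C c) (Ideal.mem_sup_right (Ideal.subset_span rfl))
    rw [map_sub, MvPolynomial.aeval_X, MvPolynomial.aeval_C] at h2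
    exact sub_eq_zero.mp h2
  · intro P hP
    exact ha P (Ideal.mem_sup_left hP)



/-- The index type `{j : Fin 2 // j ≠ 1}` has exactly one element. [folklore] -/
@[reducible] def uniqueNeOne : Unique {j : Fin 2 // j ≠ 1} :=
  ⟨⟨⟨0, by decide⟩⟩, fun ⟨j, hj⟩ => Subtype.ext (by
    fin_cases j
    · rfl
    · exact absurd rfl hj)⟩

/-- The image of `{1}ᶜ ⊆ Fin 2` under `![a, b]` is `{a}`. [folklore] -/
theorem image_compl_one (a b : ℂ) : (![a, b] : Fin 2 → ℂ) '' ({1}ᶜ : Set (Fin 2)) = {a} := by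
  ext z
  simp only [Set.mem_image, Set.mem_compl_iff, Set.mem_singleton_iff]
  constructor
  · rintro ⟨j, hj, rfl⟩
    fin_cases j
    · rfl
    · exact absurd rfl hj
  · rintro rfl
    exact ⟨0, by decide, rfl⟩

/-- A dependent pair with transcendental first coordinate: the second is algebraic over the
first. [folklore] -/
theorem isAlgebraic_adjoin_of_not_algebraicIndependent {a b : ℂ} (ha : Transcendental ℚ a)
    (h : ¬ AlgebraicIndependent ℚ ![a, b]) : IsAlgebraic (Algebra.adjoin ℚ ({a} : Set ℂ)) b := by
  rw [AlgebraicIndependent.iff_transcendental_adjoin_image (1 : Fin 2)] at h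
  have h1 : AlgebraicIndependent ℚ (fun j : {j : Fin 2 // j ≠ 1} => (![a, b] : Fin 2 → ℂ) j) := by
    letI := uniqueNeOne
    rw [algebraicIndependent_unique_type_iff]
    exact ha
  rw [image_compl_one] at h
  by_contra hb
  exact h ⟨h1, hb⟩

/-- Algebraic dependence of a pair is symmetric. [folklore] -/
theorem not_algebraicIndependent_swap {a b : ℂ} (h : ¬ AlgebraicIndependent ℚ ![a, b]) :
    ¬ AlgebraicIndependent ℚ ![b, a] := by
  intro h'
  apply h
  have e : (![a, b] : Fin 2 → ℂ) = ![b, a] ∘ Fin.rev := by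
    ext j; fin_cases j <;> rfl
  rw [e]
  exact (algebraicIndependent_equiv Fin.revPerm).mpr h'

/-- EXCHANGE: if `b` is transcendental and algebraic over `ℚ[a]`, then `a` is algebraic over
`ℚ[b]`. [folklore] -/
theorem isAlgebraic_adjoin_exchange {a b : ℂ} (hb : Transcendental ℚ b)
    (hab : IsAlgebraic (Algebra.adjoin ℚ ({a} : Set ℂ)) b) :
    IsAlgebraic (Algebra.adjoin ℚ ({b} : Set ℂ)) a := by
  apply isAlgebraic_adjoin_of_not_algebraicIndependent hb
  apply not_algebraicIndependent_swap
  intro hind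
  rw [AlgebraicIndependent.iff_transcendental_adjoin_image (1 : Fin 2), image_compl_one] at hind
  exact hind.2 hab

/-- LOG SECTOR, ALGEBRAIC PERIOD, preparation: if `2πi =: s` is algebraic over `ℚ[x₀, x₁]` and
`x₀, x₁` are algebraically dependent transcendentals, then `x₀, x₁` are algebraic over `ℚ[s]`.
[folklore] -/
theorem isAlgebraic_adjoin_period {x : Fin 2 → ℂ} {s : ℂ} (hs : Transcendental ℚ s)
    (hx : ∀ j, Transcendental ℚ (x j)) {F : MvPolynomial (Fin 2) ℚ} (hF : F ≠ 0)
    (hFx : MvPolynomial.aeval x F = 0)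
    (hT : IsAlgebraic (Algebra.adjoin ℚ (Set.range x)) s) :
    ∀ j, IsAlgebraic (Algebra.adjoin ℚ ({s} : Set ℂ)) (x j) := by
  have ex : x = ![x 0, x 1] := by ext j; fin_cases j <;> rfl
  have hdep : ¬ AlgebraicIndependent ℚ ![x 0, x 1] := by
    intro h
    rw [algebraicIndependent_iff] at h
    exact hF (h F (by rw [← ex]; exact hFx))
  have h10 : IsAlgebraic (Algebra.adjoin ℚ ({x 0} : Set ℂ)) (x 1) :=
    isAlgebraic_adjoin_of_not_algebraicIndependent (hx 0) hdep
  have h01 : IsAlgebraic (Algebra.adjoin ℚ ({x 1} : Set ℂ)) (x 0) :=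
    isAlgebraic_adjoin_of_not_algebraicIndependent (hx 1) (not_algebraicIndependent_swap hdep)
  have hrange : Set.range x = {x 0, x 1} := by
    rw [ex]
    ext z
    simp only [Matrix.range_cons, Matrix.range_empty, Set.union_empty, Set.union_singleton,
      Set.mem_insert_iff, Set.mem_singleton_iff]
    tauto
  rw [hrange] at hT
  have hs0 : IsAlgebraic (Algebra.adjoin ℚ ({x 0} : Set ℂ)) s := by
    refine IsAlgebraic.adjoin_of_forall_isAlgebraic (s := {x 0, x 1}) (t := {x 0}) ?_ hT
    intro y hy
    rcases hy with ⟨hy, hy'⟩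
    rcases hy with rfl | rfl
    · exact absurd rfl hy'
    · exact h10
  have hs1 : IsAlgebraic (Algebra.adjoin ℚ ({x 1} : Set ℂ)) s := by
    refine IsAlgebraic.adjoin_of_forall_isAlgebraic (s := {x 0, x 1}) (t := {x 1}) ?_ hT
    intro y hy
    rcases hy with ⟨hy, hy'⟩
    rcases hy with rfl | rfl
    · exact h01
    · exact absurd rfl hy'
  intro j
  fin_cases j
  · exact isAlgebraic_adjoin_exchange hs hs0
  · exact isAlgebraic_adjoin_exchange hs hs1



end Literature.NumberTheory.Transcendental.Specialization

end
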